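import Summits.Ventures.PercRepro.ProfilePointedCircuitClassesStarSharpPencilC
import Summits.Ventures.PercRepro.ProfilePointedCircuitClassesStarSharpD0J

/-!
# PercRepro — THE PENCIL THROUGH `ℓ ∈ X`, PART D: THE DATA OF A BAD DEMAND WITH `c1` AVOIDING `ℓ`
(p5, gen 56; `proofs/P5-GM1.md` §83)

A bad demand `π + e + b` with `c1` and `ℓ ∉ π` is a B1 defect — `e ∈ cl(X ∖ π)` (`pencilX_mem_of_swap`) — whose
complement `X ∖ π = {ℓ, u, v}` spans a plane through the ON line `eℓ`; its endpoints and the points `u, v` lie off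
the line `eℓ` and off the plane `P_f = cl{e, f, ℓ}` (`pencilX_D1_data`).  The plane `cl(π + e)` contains `ℓ` and
the two planes `cl(π + e)`, `cl(X ∖ π)` through `eℓ` are distinct (`X` has rank 4).
-/

open scoped Matroid

namespace PercRepro.Cogirth

open Finset ThmH Skew Shadow Profile

open Classical

variable {α : Type} [DecidableEq α] {N : Matroid α} [N.Finite]

section StarSharpPencilD

variable {b b' : α}

/-- If `S ⊆ T` have the same rank and `z ∈ cl(T)`, then `z ∈ cl(S)`. -/
theorem rk_insert_eq_of_subset_rk_eq {S T : Finset α} {z : α} (hST : S ⊆ T) (hrk : rk N T = rk N S)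
    (hz : rk N (insert z T) = rk N T) : rk N (insert z S) = rk N S := by
  have h1 : rk N (insert z S) ≤ rk N (insert z T) := rk_mono' (insert_subset_insert _ hST)
  have h2 : rk N S ≤ rk N (insert z S) := rk_mono' (subset_insert _ _)
  omega

/-- `{l, x} + e = {e, l} + x`. -/
theorem insert_e_lx_eq (e l x : α) : insert e ({l, x} : Finset α) = insert x {e, l} := by
  ext z; simp only [mem_insert, mem_singleton]; tauto

/-- `{x, y} + e = {e, x, y}` with the pair reversed. -/
theorem insert_e_pair_swap (e x y : α) : insert e ({x, y} : Finset α) = insert e {y, x} := by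
  rw [pair_comm']

/-- `{ℓ, x} + e + x′ ⊆ {x, x′} + e + ℓ`. -/
theorem insert_x'_elx_subset (e l x x' : α) :
    insert x' (insert e ({l, x} : Finset α)) ⊆ insert l (insert e {x, x'}) := by
  intro z hz; simp only [mem_insert, mem_singleton] at hz ⊢; tauto

/-- `{x, x′} + e + f ⊆ {ℓ, x} + e + f + x′`. -/
theorem insert_f_e_pair_subset_insert_x' (e f l x x' : α) :
    insert f (insert e ({x, x'} : Finset α)) ⊆ insert x' (insert f (insert e {l, x})) := by
  intro z hz; simp only [mem_insert, mem_singleton] at hz ⊢; tauto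

/-- The standing facts of case D0 at a pair `π ⊆ X`: the cardinality of `X ∖ π`. -/
theorem card_X_sdiff_pair (hn : (gr N).card = 9) (h : SeriesPair N b b') {e f : α} (he : e ∈ gr N) (hf : f ∈ gr N)
    (hef : e ≠ f) (heb : e ≠ b) (heb' : e ≠ b') (hfb : f ≠ b) (hfb' : f ≠ b') {π : Finset α}
    (hπX : π ⊆ ((((gr N).erase b).erase b').erase f).erase e) (hπ2 : π.card = 2) :
    (((((gr N).erase b).erase b').erase f).erase e \ π).card = 3 := by
  rw [card_sdiff_of_subset hπX, card_X_eq_five hn h he hf hef heb heb' hfb hfb', hπ2]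

/-- **THE DATA OF A BAD DEMAND WITH `c1` AVOIDING `ℓ`** (a D1 demand): `X ∖ π` has rank 3 and contains `e` in its
closure (B1), contains `ℓ`; `ℓ ∈ cl(π + e)`; every endpoint of `π` and every point of `X ∖ π − ℓ` is off the plane
`P_f` (`ρ{e, f, ℓ, x} = 4`). -/
theorem pencilX_D1_data (hn : (gr N).card = 9) (hR : rk N (gr N) = 5) (h : SeriesPair N b b') {e f : α}
    (he : e ∈ gr N) (hf : f ∈ gr N) (hef : e ≠ f) (heb : e ≠ b) (heb' : e ≠ b') (hfb : f ≠ b) (hfb' : f ≠ b')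
    (he1 : ∀ y ∈ ((((gr N).erase b).erase b').erase f).erase e, rk N {e, y} = 2)
    (hfc : ∀ y ∈ ((((gr N).erase b).erase b').erase f).erase e, rk N (((((gr N).erase b).erase b').erase f).erase y) = 4)
    (heb3 : rk N {e, b, b'} = 3)
    (hbg : ∀ y ∈ ((((gr N).erase b).erase b').erase f).erase e, rk N {y, b, b'} = 3)
    {l : α} (hlX : l ∈ ((((gr N).erase b).erase b').erase f).erase e) (hlon : rk N (insert b (insert b' {e, l})) = 3)
    {W : Finset α} (hW : W ∈ d0DON N b' e f) (hc1 : d0c1 N b e f W) (hc2 : ¬ d0c2 N b b' e f W) (hlW : l ∉ W) :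
    rk N (((((gr N).erase b).erase b').erase f).erase e \ (W.erase b).erase e) = 3 ∧
    rk N (insert e (((((gr N).erase b).erase b').erase f).erase e \ (W.erase b).erase e)) = 3 ∧
    l ∈ ((((gr N).erase b).erase b').erase f).erase e \ (W.erase b).erase e ∧
    rk N (insert l (insert e ((W.erase b).erase e))) = 3 ∧
    (∀ x ∈ (W.erase b).erase e, rk N (insert f (insert e {l, x})) = 4) ∧
    (∀ y ∈ (((((gr N).erase b).erase b').erase f).erase e \ (W.erase b).erase e).erase l,
      rk N (insert f (insert e {l, y})) = 4) := by
  set X := ((((gr N).erase b).erase b').erase f).erase e with hXdef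
  have hXE : X ⊆ ((gr N).erase b).erase b' := (erase_subset _ _).trans (erase_subset _ _)
  have hXg : X ⊆ gr N := hXE.trans ((erase_subset _ _).trans (erase_subset _ _))
  have heE : e ∈ ((gr N).erase b).erase b' := mem_erase.2 ⟨heb', mem_erase.2 ⟨heb, he⟩⟩
  have hWd := hW
  simp only [d0DON, mem_filter] at hWd
  obtain ⟨hbW, hπX, hπ2, hYeq, hWeq, hπe, hYf, hon⟩ :=
    d0_demand_data h hn hf hef heb hfb hfb' (e := e) W hWd.1 hWd.2.1 hWd.2.2
  set π := (W.erase b).erase e with hπdef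
  have hτ3 : rk N (X \ π) = 3 := d0_S3 h hn he hf hef heb heb' hfb hfb' π hπX hπ2 hYf
  have hτE : X \ π ⊆ ((gr N).erase b).erase b' := sdiff_subset.trans hXE
  have hτg : X \ π ⊆ gr N := hτE.trans ((erase_subset _ _).trans (erase_subset _ _))
  have hlπ : l ∉ π := fun h' => hlW (mem_of_mem_erase (mem_of_mem_erase h'))
  have hlτ : l ∈ X \ π := mem_sdiff.2 ⟨hlX, hlπ⟩
  -- B1: `e ∈ cl(X ∖ π)`
  have hB1 : rk N (insert e (X \ π)) = 3 := by
    by_contra hne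
    have h1 := rk_insert_le_add_one (N := N) he (X := X \ π) hτg
    have h2 : rk N (X \ π) ≤ rk N (insert e (X \ π)) := rk_mono' (subset_insert _ _)
    have hswap2 : rk N (insert e (X \ π)) = 4 := by omega
    exact hlπ (pencilX_mem_of_swap hn hR h he hf hef heb heb' hfb hfb' hbg hlX hlon hW hc2 hswap2)
  -- `ℓ ∈ cl(π + e)`
  have hπeE : insert e π ⊆ ((gr N).erase b).erase b' := insert_subset heE (hπX.trans hXE)
  have hlcl : rk N (insert l (insert e π)) = 3 := by
    have := (on_iff_of_line_el h he he1 heb3 hlX hlon hπeE (mem_insert_self _ _)).1 (by rw [hπe]; exact hon)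
    rw [this, hπe]
  refine ⟨hτ3, hB1, hlτ, hlcl, ?_, ?_⟩
  · -- the endpoints of `π` are off `P_f`
    intro x hx
    obtain ⟨x', hx'x, hx'π, hπeq⟩ := pair_eq_insert_of_mem hπ2 hx
    have hxX : x ∈ X := hπX hx
    have hx'X : x' ∈ X := hπX hx'π
    have hxe : x ≠ e := (mem_erase.1 hxX).1
    have hel2 : rk N {e, l} = 2 := he1 l hlX
    -- `x ∉ L`
    have hxL : rk N (insert x {e, l}) = 3 := by
      by_contra hne
      have h1 := rk_insert_le_add_one (N := N) (hXg hxX) (X := ({e, l} : Finset α))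
        (insert_subset he (singleton_subset_iff.2 (hXg hlX)))
      have h2 : rk N {e, l} ≤ rk N (insert x {e, l}) := rk_mono' (subset_insert _ _)
      have hxcl : rk N (insert x {e, l}) = rk N {e, l} := by omega
      have hsub : ({e, l} : Finset α) ⊆ insert e (X \ π) :=
        insert_subset (mem_insert_self _ _) (singleton_subset_iff.2 (mem_insert_of_mem hlτ))
      have h3 := rk_insert_eq_of_rk_insert_eq_subset' (N := N) hsub hxcl
      rw [hB1] at h3
      have h4 : ((((gr N).erase b).erase b').erase f).erase x' ⊆ insert x (insert e (X \ π)) := by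
        intro z hz
        have hzx' : z ≠ x' := (mem_erase.1 hz).1
        have hzf : z ≠ f := (mem_erase.1 (mem_erase.1 hz).2).1
        have hzE : z ∈ ((gr N).erase b).erase b' := mem_of_mem_erase (mem_of_mem_erase hz)
        by_cases hzx : z = x
        · rw [hzx]; exact mem_insert_self _ _
        by_cases hze : z = e
        · rw [hze]; exact mem_insert_of_mem (mem_insert_self _ _)
        · refine mem_insert_of_mem (mem_insert_of_mem (mem_sdiff.2 ⟨mem_erase.2 ⟨hze, mem_erase.2 ⟨hzf, hzE⟩⟩, ?_⟩))
          rw [hπeq]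
          simp only [mem_insert, mem_singleton, not_or]
          exact ⟨hzx, hzx'⟩
      have h5 := rk_mono' (M := N) h4
      rw [hfc x' hx'X, h3] at h5
      omega
    -- `x' ∈ cl{e, l, x}`
    have hx'cl : rk N (insert x' (insert e {l, x})) = rk N (insert e {l, x}) := by
      have h1 : insert x' (insert e {l, x}) ⊆ insert l (insert e π) := by
        rw [hπeq]; exact insert_x'_elx_subset e l x x'
      have h2 := rk_mono' (M := N) h1
      rw [hlcl] at h2
      have h3 : rk N (insert e {l, x}) ≤ rk N (insert x' (insert e {l, x})) := rk_mono' (subset_insert _ _)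
      rw [insert_e_lx_eq] at h2 h3 ⊢
      rw [hxL] at h3 ⊢
      omega
    have h6 := rk_insert_eq_of_rk_insert_eq_subset' (N := N) (S := insert e {l, x})
      (S' := insert f (insert e {l, x})) (subset_insert _ _) hx'cl
    have h7 : insert f (insert e π) ⊆ insert x' (insert f (insert e {l, x})) := by
      rw [hπeq]; exact insert_f_e_pair_subset_insert_x' e f l x x'
    have h8 := rk_mono' (M := N) h7
    unfold d0c1 at hc1
    rw [hc1, h6] at h8
    have h9 := rk_le_card' (M := N) (insert f (insert e ({l, x} : Finset α)))
    have h10 := card_insert_le f (insert e ({l, x} : Finset α))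
    have h11 := card_insert_le e ({l, x} : Finset α)
    have h12 := card_le_two (a := l) (b := x)
    omega
  · -- the points of `X ∖ π − ℓ` are off `P_f`
    intro y hy
    have hyτ : y ∈ X \ π := mem_of_mem_erase hy
    have hyl : y ≠ l := (mem_erase.1 hy).1
    have hyX : y ∈ X := (mem_sdiff.1 hyτ).1
    have hyπ : y ∉ π := (mem_sdiff.1 hyτ).2
    have hτc : (X \ π).card = 3 := card_X_sdiff_pair hn h he hf hef heb heb' hfb hfb' hπX hπ2
    have hτl2 : ((X \ π).erase l).card = 2 := by rw [card_erase_of_mem hlτ, hτc]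
    obtain ⟨v, hvy, hv, hτeq⟩ := pair_eq_insert_of_mem hτl2 hy
    have hvτ : v ∈ X \ π := mem_of_mem_erase hv
    have hτform : X \ π = insert l {y, v} := by rw [← hτeq, insert_erase hlτ]
    -- `y ∉ L`
    have hyL : rk N (insert y {e, l}) = 3 := by
      by_contra hne
      have h1 := rk_insert_le_add_one (N := N) (hXg hyX) (X := ({e, l} : Finset α))
        (insert_subset he (singleton_subset_iff.2 (hXg hlX)))
      have h2 : rk N {e, l} ≤ rk N (insert y {e, l}) := rk_mono' (subset_insert _ _)
      have hel2 : rk N {e, l} = 2 := he1 l hlX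
      have hycl : rk N (insert y {e, l}) = rk N {e, l} := by omega
      have hsub : ({e, l} : Finset α) ⊆ insert l (insert e π) :=
        insert_subset (mem_insert_of_mem (mem_insert_self _ _)) (singleton_subset_iff.2 (mem_insert_self _ _))
      have h3 := rk_insert_eq_of_rk_insert_eq_subset' (N := N) hsub hycl
      rw [hlcl] at h3
      have h4 : ((((gr N).erase b).erase b').erase f).erase v ⊆ insert y (insert l (insert e π)) := by
        intro z hz
        have hzv : z ≠ v := (mem_erase.1 hz).1
        have hzf : z ≠ f := (mem_erase.1 (mem_erase.1 hz).2).1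
        have hzE : z ∈ ((gr N).erase b).erase b' := mem_of_mem_erase (mem_of_mem_erase hz)
        by_cases hzy : z = y
        · rw [hzy]; exact mem_insert_self _ _
        by_cases hzl : z = l
        · rw [hzl]; exact mem_insert_of_mem (mem_insert_self _ _)
        by_cases hze : z = e
        · rw [hze]; exact mem_insert_of_mem (mem_insert_of_mem (mem_insert_self _ _))
        have hzX : z ∈ X := mem_erase.2 ⟨hze, mem_erase.2 ⟨hzf, hzE⟩⟩
        by_cases hzπ : z ∈ π
        · exact mem_insert_of_mem (mem_insert_of_mem (mem_insert_of_mem hzπ))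
        · have hzτ : z ∈ X \ π := mem_sdiff.2 ⟨hzX, hzπ⟩
          rw [hτform] at hzτ
          simp only [mem_insert, mem_singleton] at hzτ
          rcases hzτ with h' | h' | h'
          · exact absurd h' hzl
          · exact absurd h' hzy
          · exact absurd h' hzv
      have h5 := rk_mono' (M := N) h4
      rw [hfc v (mem_sdiff.1 hvτ).1, h3] at h5
      omega
    by_contra hne
    have h1 := rk_insert_le_add_one (N := N) hf (X := insert e ({l, y} : Finset α))
      (insert_subset he (insert_subset (hXg hlX) (singleton_subset_iff.2 (hXg hyX))))
    have h2 : rk N (insert e {l, y}) ≤ rk N (insert f (insert e {l, y})) := rk_mono' (subset_insert _ _)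
    have hyL' : rk N (insert e {l, y}) = 3 := by rw [insert_e_lx_eq]; exact hyL
    rw [hyL'] at h1 h2
    have hfcl : rk N (insert f (insert e {l, y})) = rk N (insert e {l, y}) := by
      rw [hyL']; omega
    have hsub : insert e ({l, y} : Finset α) ⊆ insert e (X \ π) :=
      insert_subset (mem_insert_self _ _) (insert_subset (mem_insert_of_mem hlτ)
        (singleton_subset_iff.2 (mem_insert_of_mem hyτ)))
    have h3 := rk_insert_eq_of_rk_insert_eq_subset' (N := N) hsub hfcl
    rw [hB1] at h3
    have h4 : rk N (insert f (X \ π)) ≤ rk N (insert f (insert e (X \ π))) :=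
      rk_mono' (insert_subset_insert _ (subset_insert _ _))
    rw [hYf, h3] at h4
    omega

/-- `((B − e) − f) = {x, y}` for `B = {x, y} + e + f`. -/
theorem erase_erase_insert_f_insert_e {e f x y : α} (hxe : x ≠ e) (hxf : x ≠ f) (hye : y ≠ e) (hyf : y ≠ f) :
    ((insert f (insert e ({x, y} : Finset α))).erase e).erase f = {x, y} := by
  ext z
  simp only [mem_erase, mem_insert, mem_singleton]
  constructor
  · rintro ⟨hzf, hze, (rfl | rfl | rfl | rfl)⟩
    · exact absurd rfl hzf
    · exact absurd rfl hze
    · exact Or.inl rfl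
    · exact Or.inr rfl
  · rintro (rfl | rfl)
    · exact ⟨hxf, hxe, Or.inr (Or.inr (Or.inl rfl))⟩
    · exact ⟨hyf, hye, Or.inr (Or.inr (Or.inr rfl))⟩

/-- `{ℓ, x} + e ⊆ {x, y} + e + ℓ`. -/
theorem insert_e_lx_subset_insert_l_e_xy (e l x y : α) :
    insert e ({l, x} : Finset α) ⊆ insert l (insert e {x, y}) := by
  intro z hz; simp only [mem_insert, mem_singleton] at hz ⊢; tauto

/-- `{ℓ, x} + e + y ⊆ {x, y} + e + ℓ`. -/
theorem insert_y_e_lx_subset (e l x y : α) :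
    insert y (insert e ({l, x} : Finset α)) ⊆ insert l (insert e {x, y}) := by
  intro z hz; simp only [mem_insert, mem_singleton] at hz ⊢; tauto

/-- `{ℓ, x′} + e ⊆ {x, x′} + e + ℓ`. -/
theorem insert_e_lx'_subset_insert_l_e_pair (e l x x' : α) :
    insert e ({l, x'} : Finset α) ⊆ insert l (insert e {x, x'}) := by
  intro z hz; simp only [mem_insert, mem_singleton] at hz ⊢; tauto

/-- `{x, x′} + e + y′ ⊆ (X ∖ {x, y}) + e + x` when `x′, y′ ∈ X ∖ {x, y}`: stated on an abstract set `S`. -/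
theorem insert_y'_e_pair_subset_insert_x_e {S : Finset α} {e x x' y' : α} (hx' : x' ∈ S) (hy' : y' ∈ S) :
    insert y' (insert e ({x, x'} : Finset α)) ⊆ insert x (insert e S) := by
  intro z hz; simp only [mem_insert, mem_singleton] at hz ⊢
  rcases hz with rfl | rfl | rfl | rfl
  · exact Or.inr (Or.inr hy')
  · exact Or.inr (Or.inl rfl)
  · exact Or.inl rfl
  · exact Or.inr (Or.inr hx')

/-- `{e, f, y} ⊆ ({x, y} + e + f) ∩ ({x′, y} + e + f)`. -/
theorem efy_subset_inter (e f x x' y : α) :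
    ({e, f, y} : Finset α) ⊆ insert f (insert e {x, y}) ∩ insert f (insert e {x', y}) := by
  intro z hz; simp only [mem_inter, mem_insert, mem_singleton] at hz ⊢; tauto

/-- `{x, x′} + e + y ⊆ ({x, y} + e + f) ∪ ({x′, y} + e + f)`. -/
theorem insert_y_e_pair_subset_union (e f x x' y : α) :
    insert y (insert e ({x, x'} : Finset α)) ⊆ insert f (insert e {x, y}) ∪ insert f (insert e {x', y}) := by
  intro z hz; simp only [mem_union, mem_insert, mem_singleton] at hz ⊢; tauto

/-- **A POINT OF `X ∖ π − ℓ` IS OFF THE PLANE `cl(π + e)`** of a D1 demand: `ρ(π + e + y) = 4` (else `cl{e, ℓ, y}`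
would contain `π` and `X ∖ π`, and `X` would have rank 3). -/
theorem pencilX_D1_rk_insert_eq_four {e f : α} (hX : rk N (((((gr N).erase b).erase b').erase f).erase e) = 4)
    {π : Finset α} (hπ2 : π.card = 2) (hπe : rk N (insert e π) = 3)
    (hB1 : rk N (insert e (((((gr N).erase b).erase b').erase f).erase e \ π)) = 3)
    {l : α} (hlτ : l ∈ ((((gr N).erase b).erase b').erase f).erase e \ π)
    (hlcl : rk N (insert l (insert e π)) = 3)
    {y : α} (hy : y ∈ (((((gr N).erase b).erase b').erase f).erase e \ π).erase l)
    (hyL : rk N (insert e {l, y}) = 3) : rk N (insert y (insert e π)) = 4 := by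
  set X := ((((gr N).erase b).erase b').erase f).erase e with hXdef
  have hyτ : y ∈ X \ π := mem_of_mem_erase hy
  by_contra hne
  have h1 : rk N (insert e π) ≤ rk N (insert y (insert e π)) := rk_mono' (subset_insert _ _)
  have h2 := rk_le_card' (M := N) (insert y (insert e π))
  have h3 := card_insert_le y (insert e π)
  have h4 := card_insert_le e π
  have hycl : rk N (insert y (insert e π)) = rk N (insert e π) := by omega
  have hlcl' : rk N (insert l (insert e π)) = rk N (insert e π) := by rw [hlcl, hπe]
  have hU := rk_insert_eq_of_rk_insert_eq_subset' (N := N) (S := insert e π) (S' := insert y (insert e π))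
    (subset_insert _ _) hlcl'
  have hU3 : rk N (insert l (insert y (insert e π))) = 3 := by rw [hU, hycl, hπe]
  have hTU : insert e ({l, y} : Finset α) ⊆ insert l (insert y (insert e π)) :=
    insert_subset (mem_insert_of_mem (mem_insert_of_mem (mem_insert_self _ _)))
      (insert_subset (mem_insert_self _ _) (singleton_subset_iff.2 (mem_insert_of_mem (mem_insert_self _ _))))
  have hTV : insert e ({l, y} : Finset α) ⊆ insert e (X \ π) :=
    insert_subset (mem_insert_self _ _) (insert_subset (mem_insert_of_mem hlτ)
      (singleton_subset_iff.2 (mem_insert_of_mem hyτ)))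
  have hall : ∀ z ∈ X, rk N (insert z (insert e {l, y})) = rk N (insert e {l, y}) := by
    intro z hz
    by_cases hzπ : z ∈ π
    · have hzU : z ∈ insert l (insert y (insert e π)) :=
        mem_insert_of_mem (mem_insert_of_mem (mem_insert_of_mem hzπ))
      exact rk_insert_eq_of_subset_rk_eq hTU (by rw [hU3, hyL]) (by rw [insert_eq_of_mem hzU])
    · have hzV : z ∈ insert e (X \ π) := mem_insert_of_mem (mem_sdiff.2 ⟨hz, hzπ⟩)
      exact rk_insert_eq_of_subset_rk_eq hTV (by rw [hB1, hyL]) (by rw [insert_eq_of_mem hzV])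
  have h5 := rk_union_eq_of_forall_insert_eq (N := N) (Y := insert e {l, y}) X hall
  have h6 : rk N X ≤ rk N (insert e {l, y} ∪ X) := rk_mono' subset_union_right
  rw [h5, hyL, hX] at h6
  omega

end StarSharpPencilD

end PercRepro.Cogirth
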